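import Literature.NumberTheory.LFunctions.RayClassLFunctionZeroFreeRegion
import Literature.NumberTheory.LFunctions.ClassGroupLFunctionRealZeros
import HarnessLib

/-!
# Real zeros of Hecke `L`-functions of ray class characters near `s = 1`: at most one per character, and Landau's
# repulsion across two real characters `mod 𝔪` (Thorner–Zaman 2019 Theorem 3.1, uniformly in the field and the modulus)

Topic `Literature/NumberTheory/LFunctions`, namespace `Literature.NumberTheory.LFunctions`.
Everything here is PROVED (theorems only; no named facts).

The ray-class counterpart of `ClassGroupLFunctionZeroFreeRegion.lean` (the `UniformTwistedZFRData` datum) and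
`ClassGroupLFunctionRealZeros.lean`.  For a ray class character `ψ mod 𝔪 ≠ 0` non-principal on the primes `∤ 𝔪`, with
primitive data `D` and entire imprimitive `L`-function `L_𝔪(s, ψ) = D.LMod`:
* `RayClassPrimitiveData.uniformTwistedZFRData_of_ne` / `_of_eq` — the datum `UniformTwistedZFRData` with the conductor
  parameter `Q = |d_K| N𝔪`, `η = 1`, `A = n_K + 2`, `C_g = e^{2n_K}(3/2)^{n_K}`, `c₁ = 32e^{−32 n_K}`, `K₀ = 77760(5n_K+2)`,
  `C₂ = 77761(5n_K+2)`;
* `exists_min_realZeros_rayClass_le (n)` — **at most one real zero near `1`**: `c = c(n) > 0` with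
  `min(β₀, β₁) ≤ 1 − c/(log(|d_K|N𝔪) + log 4)` for two distinct real zeros of `L(s, χ₀)`, `n_K ≤ n`;
* `landau_positivity_rayClass` — `Re[L(Λ_K,σ) + L(Λ_{ψ₁},σ) + L(Λ_{ψ₂},σ) + L(Λ_{ψ₁ψ₂},σ)] ≥ 0` for real `ψ₁, ψ₂ mod 𝔪`;
* `exists_landau_rayClass (n)` — **Landau–Page across two different real characters `mod 𝔪`**:
  `min(β₁, β₂) ≤ 1 − c/(log(|d_K|N𝔪) + log 4)` for real zeros `β_i` of `L(s, (ψ_i)₀)`, `ψ₁ ≠ ψ₂` off `𝔪`, `n_K ≤ n`.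

## References
* [ThornerZaman2019] J. Thorner, A. Zaman, Algebra & Number Theory 13 (2019), Theorem 3.1.
* [MontgomeryVaughan2007] H. L. Montgomery, R. C. Vaughan, *Multiplicative Number Theory I*, Theorems 11.3, 11.7, Lemma 11.6.
-/

noncomputable section

open scoped NumberField nonZeroDivisors ComplexConjugate
open Complex Filter Topology Set Metric NumberField IsDedekindDomain Finset

namespace Literature.NumberTheory.LFunctions

open Literature.NumberTheory.LFunctions.NumberField Literature.NumberTheory.LFunctions.LogFreeLocal
open scoped Classical

variable {K : Type*} [Field K] [NumberField K] {𝔪 : Ideal (𝓞 K)} {ψ : HeightOneSpectrum (𝓞 K) → ℂ}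

/-! ### The conductor parameter `Q = |d_K| N𝔪` -/

variable (K) in
/-- `Q = |d_K| · N𝔪`. [cite: ThornerZaman2019, Theorem 3.1] -/
theorem one_le_discr_mul_absNorm (h𝔪 : 𝔪 ≠ ⊥) : (1 : ℝ) ≤ ((discr K).natAbs : ℝ) * ((Ideal.absNorm 𝔪 : ℕ) : ℝ) := by
  have hd1 : (1 : ℝ) ≤ ((discr K).natAbs : ℝ) := by exact_mod_cast Int.natAbs_pos.mpr (discr_ne_zero K)
  have hm : (1 : ℝ) ≤ ((Ideal.absNorm 𝔪 : ℕ) : ℝ) := by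
    exact_mod_cast Nat.one_le_iff_ne_zero.mpr (by rwa [Ne, Ideal.absNorm_eq_zero_iff])
  nlinarith

/-- `M_{K,𝔪}(t) ≤ (5n_K + 2)(log(|d_K|N𝔪) + log(|t| + 4))`. [cite: ThornerZaman2019, Theorem 3.1] -/
theorem modDiscBound_le (h𝔪 : 𝔪 ≠ ⊥) (t : ℝ) :
    modDiscBound K 𝔪 t ≤ (5 * Module.finrank ℚ K + 2) *
      (Real.log (((discr K).natAbs : ℝ) * ((Ideal.absNorm 𝔪 : ℕ) : ℝ)) + Real.log (|t| + 4)) := by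
  have h1 := discBound_le (K := K) t
  have hd : (0 : ℝ) < ((discr K).natAbs : ℝ) := by exact_mod_cast Int.natAbs_pos.mpr (discr_ne_zero K)
  have hm : (0 : ℝ) < ((Ideal.absNorm 𝔪 : ℕ) : ℝ) := by
    exact_mod_cast Nat.pos_of_ne_zero (by rwa [Ne, Ideal.absNorm_eq_zero_iff])
  rw [modDiscBound, Real.log_mul hd.ne' hm.ne']
  have h2 : 0 ≤ Real.log (Ideal.absNorm 𝔪 : ℕ) := Real.log_natCast_nonneg _
  have h3 : (0 : ℝ) ≤ Module.finrank ℚ K := Nat.cast_nonneg _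
  nlinarith

namespace RayClassPrimitiveData

variable (D : RayClassPrimitiveData 𝔪 ψ)

/-- The parameters are admissible. [cite: ThornerZaman2019, Theorem 3.1] -/
theorem uzfrParams_nonneg (n : ℕ) :
    (0 : ℝ) ≤ n + 2 ∧ (0 : ℝ) < Real.exp (2 * n) * (3 / 2) ^ n ∧
      (0 : ℝ) < 32 * Real.exp (-(32 * n)) ∧ (0 : ℝ) ≤ 77760 * (5 * n + 2) ∧
      (0 : ℝ) ≤ 77761 * (5 * n + 2) :=
  ⟨by positivity, by positivity, by positivity, by positivity, by positivity⟩

/-- The growth of `L_𝔪(s, ψ)` in the `Q^A (|t|+4)^A` form, `0 ≤ σ ≤ 3`. [cite: ThornerZaman2019, Theorem 3.1] -/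
theorem norm_LMod_le_pow (hnt : ∃ v : HeightOneSpectrum (𝓞 K), ¬ 𝔪 ≤ v.asIdeal ∧ ψ v ≠ 1) {s : ℂ} (hs0 : 0 ≤ s.re)
    (hs3 : s.re ≤ 3) :
    ‖D.LMod s‖ ≤ Real.exp (2 * Module.finrank ℚ K) * (3 / 2) ^ Module.finrank ℚ K *
      (((discr K).natAbs : ℝ) * ((Ideal.absNorm 𝔪 : ℕ) : ℝ)) ^ ((Module.finrank ℚ K : ℝ) + 2) *
      (|s.im| + 4) ^ ((Module.finrank ℚ K : ℝ) + 2) := by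
  set n : ℕ := Module.finrank ℚ K with hn
  have h𝔪 := D.modulus_ne_bot
  refine (D.norm_LMod_le hnt hs0 hs3).trans ?_
  rw [← hn]
  set Q : ℝ := ((discr K).natAbs : ℝ) * ((Ideal.absNorm 𝔪 : ℕ) : ℝ) with hQ
  have hQ1 : 1 ≤ Q := one_le_discr_mul_absNorm K h𝔪
  have hd1 : (1 : ℝ) ≤ ((discr K).natAbs : ℝ) := by exact_mod_cast Int.natAbs_pos.mpr (discr_ne_zero K)
  have hτ : 1 ≤ |s.im| + 4 := by linarith [abs_nonneg s.im]
  have hA : ((n : ℝ) + 2) = ((n + 2 : ℕ) : ℝ) := by push_cast; ring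
  rw [hA, Real.rpow_natCast, Real.rpow_natCast]
  have h1 : ((discr K).natAbs : ℝ) * ((Ideal.absNorm 𝔪 : ℕ) : ℝ) ^ 2 ≤ Q ^ (n + 2) := by
    calc ((discr K).natAbs : ℝ) * ((Ideal.absNorm 𝔪 : ℕ) : ℝ) ^ 2
        ≤ ((discr K).natAbs : ℝ) ^ 2 * ((Ideal.absNorm 𝔪 : ℕ) : ℝ) ^ 2 :=
          mul_le_mul_of_nonneg_right (by nlinarith) (sq_nonneg _)
      _ = Q ^ 2 := by rw [hQ, mul_pow]
      _ ≤ Q ^ (n + 2) := pow_le_pow_right₀ hQ1 (by omega)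
  have h2 : (|s.im| + 6) ^ n ≤ (3 / 2) ^ n * (|s.im| + 4) ^ (n + 2) := by
    have h3 : (|s.im| + 4) ^ n ≤ (|s.im| + 4) ^ (n + 2) := pow_le_pow_right₀ hτ (by omega)
    calc (|s.im| + 6) ^ n ≤ ((3 / 2) * (|s.im| + 4)) ^ n := pow_le_pow_left₀ (by positivity) (by linarith [abs_nonneg s.im]) _
      _ = (3 / 2) ^ n * (|s.im| + 4) ^ n := mul_pow _ _ _
      _ ≤ (3 / 2) ^ n * (|s.im| + 4) ^ (n + 2) := mul_le_mul_of_nonneg_left h3 (by positivity)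
  calc ((discr K).natAbs : ℝ) * ((Ideal.absNorm 𝔪 : ℕ) : ℝ) ^ 2 * Real.exp (2 * n) * (|s.im| + 6) ^ n
      = Real.exp (2 * n) * (((discr K).natAbs : ℝ) * ((Ideal.absNorm 𝔪 : ℕ) : ℝ) ^ 2) * (|s.im| + 6) ^ n := by ring
    _ ≤ Real.exp (2 * n) * Q ^ (n + 2) * ((3 / 2) ^ n * (|s.im| + 4) ^ (n + 2)) := by gcongr
    _ = _ := by ring

/-- The shared fields of the uniform datum. [cite: ThornerZaman2019, Theorem 3.1] -/
theorem uzfrData_common (hnt : ∃ v : HeightOneSpectrum (𝓞 K), ¬ 𝔪 ≤ v.asIdeal ∧ ψ v ≠ 1) :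
    let n : ℕ := Module.finrank ℚ K
    let Q : ℝ := ((discr K).natAbs : ℝ) * ((Ideal.absNorm 𝔪 : ℕ) : ℝ)
    (1 : ℝ) ≤ Q ∧
    (∀ σ : ℝ, 1 < σ → σ ≤ 2 →
      (LSeries (fun m ↦ (vonMangoldtNorm K m : ℂ)) σ).re ≤
        1 / (σ - 1) + 77760 * (5 * (n : ℝ) + 2) * (Real.log Q + Real.log 4)) ∧
    (∀ s : ℂ, 1 - (1 : ℝ) < s.re → s.re ≤ 3 →
      ‖D.LMod s‖ ≤ Real.exp (2 * n) * (3 / 2) ^ n * Q ^ ((n : ℝ) + 2) * (|s.im| + 4) ^ ((n : ℝ) + 2)) ∧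
    (∀ t : ℝ, 32 * Real.exp (-(32 * (n : ℝ))) * ((1 : ℝ) / 32) ≤ ‖D.LMod (1 + (1 : ℝ) / 32 + t * I)‖) ∧
    (∀ s : ℂ, 1 < s.re → s.re ≤ 2 → 77761 * modDiscBound K 𝔪 s.im ≤
      77761 * (5 * (n : ℝ) + 2) * (Real.log Q + Real.log (|s.im| + 4))) := by
  intro n Q
  have h𝔪 := D.modulus_ne_bot
  obtain ⟨h0, -, -⟩ := D.zfrData_common hnt
  refine ⟨one_le_discr_mul_absNorm K h𝔪, fun σ hσ hσ2 ↦ ?_, fun s hs hs3 ↦ D.norm_LMod_le_pow hnt (by linarith) hs3,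
    fun t ↦ ?_, fun s _ _ ↦ ?_⟩
  · have h := h0 σ hσ hσ2
    have hM := modDiscBound_le (K := K) h𝔪 0
    rw [abs_zero, zero_add] at hM
    nlinarith
  · have hre : (1 + (1 : ℝ) / 32 + t * I : ℂ).re = 1 + 1 / 32 := by simp
    have hs1 : 1 < (1 + (1 : ℝ) / 32 + t * I : ℂ).re := by rw [hre]; norm_num
    rw [D.LMod_eq hs1]
    refine le_trans (le_of_eq ?_) (exp_neg_finrank_div_le_norm_rayClassLSeries h𝔪 D.norm_psi_le_one hs1)
    rw [hre, show (32 : ℝ) * Real.exp (-(32 * (n : ℝ))) * (1 / 32) = Real.exp (-(32 * (n : ℝ))) by ring]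
    congr 1
    rw [show (1 : ℝ) + 1 / 32 - 1 = 1 / 32 by norm_num]
    ring
  · have hM := modDiscBound_le (K := K) h𝔪 s.im
    nlinarith

/-- **The uniform datum for `ψ²` non-principal** (`pole = false`). [cite: ThornerZaman2019, Theorem 3.1] -/
theorem uniformTwistedZFRData_of_ne (hψ : IsRayClassCharacter 𝔪 ψ)
    (hnt : ∃ v : HeightOneSpectrum (𝓞 K), ¬ 𝔪 ≤ v.asIdeal ∧ ψ v ≠ 1)
    (h2 : ∃ v : HeightOneSpectrum (𝓞 K), ¬ 𝔪 ≤ v.asIdeal ∧ ψ v ^ 2 ≠ 1) :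
    UniformTwistedZFRData 1 (Module.finrank ℚ K + 2)
      (Real.exp (2 * Module.finrank ℚ K) * (3 / 2) ^ Module.finrank ℚ K)
      (32 * Real.exp (-(32 * Module.finrank ℚ K))) (77760 * (5 * Module.finrank ℚ K + 2))
      (77761 * (5 * Module.finrank ℚ K + 2)) false (((discr K).natAbs : ℝ) * ((Ideal.absNorm 𝔪 : ℕ) : ℝ))
      (vonMangoldtNorm K) (twistVonMangoldt K (rayClassCoeffHom 𝔪 ψ))
      (twistVonMangoldt K (rayClassCoeffHom 𝔪 (fun v ↦ ψ v ^ 2))) D.LMod := by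
  have h𝔪 := D.modulus_ne_bot
  obtain ⟨hQ1, h0, hgr, hlow, hC⟩ := D.uzfrData_common hnt
  obtain ⟨hA, hCg, hc₁, hK₀, hC₂⟩ := uzfrParams_nonneg (Module.finrank ℚ K)
  have hν : ∀ I, ‖rayClassCoeffHom 𝔪 ψ I‖ ≤ 1 := norm_rayClassCoeffHom_le h𝔪 D.norm_psi_le_one
  have hψ2 : IsRayClassCharacter 𝔪 (fun v ↦ ψ v ^ 2) := hψ.pow_apply 2
  set D₂ := rayClassPrimitiveData hψ2 h𝔪 h2
  exact {
    eta_pos := one_pos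
    eta_le_one := le_rfl
    A_nonneg := hA
    Cg_pos := hCg
    c₁_pos := hc₁
    K₀_nonneg := hK₀
    C₂_nonneg := hC₂
    one_le_Q := hQ1
    nonneg := vonMangoldtNorm_nonneg
    summable := fun s hs ↦ LSeriesSummable_vonMangoldtNorm hs
    re_LSeries₀_le := h0
    norm_le₁ := norm_twistVonMangoldt_le hν
    norm_le₂ := norm_twistVonMangoldt_le (norm_rayClassCoeffHom_le h𝔪 (ψ := fun v ↦ ψ v ^ 2) D.norm_psi_sq_le_one)
    three_four_one := fun σ hσ t ↦ three_four_one hν (rayClassCoeffHom_sq 𝔪 ψ) hσ t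
    differentiableOn := D.differentiable_LMod.differentiableOn
    ne_zero := fun s hs ↦ D.LMod_ne_zero_of_one_lt_re hnt hs
    logDeriv_eq := fun s hs ↦ D.logDeriv_LMod_eq hs
    growth := fun s hs hs3 ↦ by simpa using hgr s hs hs3
    lower := fun t ↦ by simpa using hlow t
    re_LSeries₂_le := fun s hs hs2 ↦ by
      have h := re_LSeries_twist_sq_le (ψ := ψ) h2 D₂ hs hs2
      have h' := hC s hs hs2
      simp only [Bool.false_eq_true, ↓reduceIte, zero_add]
      linarith
    reflect := fun h ↦ absurd h Bool.false_ne_true }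

/-- **The uniform datum for `ψ²` principal** (`ψ` real, `pole = true`). [cite: ThornerZaman2019, Theorem 3.1] -/
theorem uniformTwistedZFRData_of_eq
    (hnt : ∃ v : HeightOneSpectrum (𝓞 K), ¬ 𝔪 ≤ v.asIdeal ∧ ψ v ≠ 1)
    (h2 : ∀ v : HeightOneSpectrum (𝓞 K), ¬ 𝔪 ≤ v.asIdeal → ψ v ^ 2 = 1) :
    UniformTwistedZFRData 1 (Module.finrank ℚ K + 2)
      (Real.exp (2 * Module.finrank ℚ K) * (3 / 2) ^ Module.finrank ℚ K)
      (32 * Real.exp (-(32 * Module.finrank ℚ K))) (77760 * (5 * Module.finrank ℚ K + 2))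
      (77761 * (5 * Module.finrank ℚ K + 2)) true (((discr K).natAbs : ℝ) * ((Ideal.absNorm 𝔪 : ℕ) : ℝ))
      (vonMangoldtNorm K) (twistVonMangoldt K (rayClassCoeffHom 𝔪 ψ))
      (twistVonMangoldt K (rayClassCoeffHom 𝔪 (fun v ↦ ψ v ^ 2))) D.LMod := by
  have h𝔪 := D.modulus_ne_bot
  obtain ⟨hQ1, h0, hgr, hlow, hC⟩ := D.uzfrData_common hnt
  obtain ⟨hA, hCg, hc₁, hK₀, hC₂⟩ := uzfrParams_nonneg (Module.finrank ℚ K)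
  have hν : ∀ I, ‖rayClassCoeffHom 𝔪 ψ I‖ ≤ 1 := norm_rayClassCoeffHom_le h𝔪 D.norm_psi_le_one
  have hreal : ∀ v : HeightOneSpectrum (𝓞 K), ¬ 𝔪 ≤ v.asIdeal → conj (ψ v) = ψ v := by
    intro v hv
    have h := h2 v hv
    rw [sq, mul_self_eq_one_iff] at h
    rcases h with h | h <;> rw [h] <;> simp
  exact {
    eta_pos := one_pos
    eta_le_one := le_rfl
    A_nonneg := hA
    Cg_pos := hCg
    c₁_pos := hc₁
    K₀_nonneg := hK₀
    C₂_nonneg := hC₂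
    one_le_Q := hQ1
    nonneg := vonMangoldtNorm_nonneg
    summable := fun s hs ↦ LSeriesSummable_vonMangoldtNorm hs
    re_LSeries₀_le := h0
    norm_le₁ := norm_twistVonMangoldt_le hν
    norm_le₂ := norm_twistVonMangoldt_le (norm_rayClassCoeffHom_le h𝔪 (ψ := fun v ↦ ψ v ^ 2) D.norm_psi_sq_le_one)
    three_four_one := fun σ hσ t ↦ three_four_one hν (rayClassCoeffHom_sq 𝔪 ψ) hσ t
    differentiableOn := D.differentiable_LMod.differentiableOn
    ne_zero := fun s hs ↦ D.LMod_ne_zero_of_one_lt_re hnt hs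
    logDeriv_eq := fun s hs ↦ D.logDeriv_LMod_eq hs
    growth := fun s hs hs3 ↦ by simpa using hgr s hs hs3
    lower := fun t ↦ by simpa using hlow t
    re_LSeries₂_le := fun s hs hs2 ↦ by
      have h := re_LSeries_twist_sq_le_of_principal (ψ := ψ) h𝔪 h2 hs hs2
      have h' := hC s hs hs2
      simp only [↓reduceIte]
      linarith
    reflect := fun _ ρ _ hρ ↦ by rw [D.LMod_conj hreal ρ, hρ, map_zero] }

/-- A real zero of `L_𝔪(s, ψ)` is `< 1`. [cite: ThornerZaman2019, Theorem 3.1] -/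
theorem realZero_lt_one (hnt : ∃ v : HeightOneSpectrum (𝓞 K), ¬ 𝔪 ≤ v.asIdeal ∧ ψ v ≠ 1) {β : ℝ}
    (hβ : D.LMod β = 0) : β < 1 := by
  by_contra h
  rw [not_lt] at h
  have hs : 1 ≤ ((β : ℂ)).re := by simpa using h
  rw [LMod] at hβ
  rcases mul_eq_zero.mp hβ with h1 | h1
  · exact D.L_ne_zero_of_one_le_re hnt hs h1
  · -- the Euler factors do not vanish for `Re s ≥ 1` (`|χ₀(𝔭) N𝔭^{-s}| ≤ 1/2`)
    rw [eulerCorr] at h1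
    obtain ⟨v, hv, hv0⟩ := Finset.prod_eq_zero_iff.mp h1
    have hN : 0 < Ideal.absNorm v.asIdeal := Nat.pos_of_ne_zero (by rw [Ne, Ideal.absNorm_eq_zero_iff]; exact v.ne_bot)
    have hN2 : (2 : ℝ) ≤ (Ideal.absNorm v.asIdeal : ℕ) := by exact_mod_cast AbelianDensity.two_le_absNorm K v
    have hc := D.norm_le_one_of_mem_badPrimes hv
    have hlt : ‖D.χ₀ v * ((Ideal.absNorm v.asIdeal : ℕ) : ℂ) ^ (-(β : ℂ))‖ < 1 := by
      rw [norm_mul, Complex.norm_natCast_cpow_of_pos hN, Complex.neg_re, Complex.ofReal_re]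
      have : ((Ideal.absNorm v.asIdeal : ℕ) : ℝ) ^ (-β) ≤ 1 / 2 := by
        calc ((Ideal.absNorm v.asIdeal : ℕ) : ℝ) ^ (-β) ≤ ((Ideal.absNorm v.asIdeal : ℕ) : ℝ) ^ (-1 : ℝ) :=
              Real.rpow_le_rpow_of_exponent_le (by linarith) (by linarith)
          _ = 1 / (Ideal.absNorm v.asIdeal : ℕ) := by rw [Real.rpow_neg_one, one_div]
          _ ≤ 1 / 2 := one_div_le_one_div_of_le (by norm_num) hN2
      calc ‖D.χ₀ v‖ * ((Ideal.absNorm v.asIdeal : ℕ) : ℝ) ^ (-β) ≤ 1 * (1 / 2) :=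
            mul_le_mul hc this (by positivity) zero_le_one
        _ < 1 := by norm_num
    rw [sub_eq_zero] at hv0
    rw [← hv0, norm_one] at hlt
    exact lt_irrefl _ hlt

end RayClassPrimitiveData

/-! ### At most one real zero per character -/

/-- **At most one real zero of `L(s, χ₀)` near `1`, uniformly in the field and the modulus** (MV Theorem 11.3, Case 4;
part of [ThornerZaman2019, Theorem 3.1]): for every `n` there is `c = c(n) > 0` such that for every `K` with `n_K ≤ n`,
`𝔪 ≠ 0`, every ray class character `ψ mod 𝔪` non-principal on the primes `∤ 𝔪`, primitive data `D`, and two distinct real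
zeros `β₀ ≠ β₁` of `L(·, χ₀)`: `min(β₀, β₁) ≤ 1 − c/(log(|d_K| N𝔪) + log 4)`.
[cite: MontgomeryVaughan2007, Theorem 11.3 (proof, Case 4)] -/
theorem exists_min_realZeros_rayClass_le (n : ℕ) :
    ∃ c : ℝ, 0 < c ∧ ∀ (K : Type*) [Field K] [NumberField K], Module.finrank ℚ K ≤ n →
      ∀ (𝔪 : Ideal (𝓞 K)) (ψ : HeightOneSpectrum (𝓞 K) → ℂ), IsRayClassCharacter 𝔪 ψ →
      (∃ v : HeightOneSpectrum (𝓞 K), ¬ 𝔪 ≤ v.asIdeal ∧ ψ v ≠ 1) →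
      ∀ (D : RayClassPrimitiveData 𝔪 ψ) (β₀ β₁ : ℝ), β₀ ≠ β₁ → D.L β₀ = 0 → D.L β₁ = 0 →
        min β₀ β₁ ≤ 1 - c / (Real.log (((discr K).natAbs : ℝ) * ((Ideal.absNorm 𝔪 : ℕ) : ℝ)) + Real.log 4) := by
  -- the constant is antitone in the degree; take the one for degree `n` and compare
  set cof : ℕ → ℝ := fun m ↦
    min (3 * (1 : ℝ) / 64) (1 / (6 * (77760 * (5 * (m : ℝ) + 2) +
      8 * (2 * ((m : ℝ) + 2) + |Real.log ((Real.exp (2 * m) * (3 / 2) ^ m) / ((32 * Real.exp (-(32 * m))) * ((1 : ℝ) / 32)))| + 1) /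
        ((1 : ℝ) / 4) + 1))) with hcof
  have hcof_pos : ∀ m, 0 < cof m := fun m ↦ by rw [hcof]; exact lt_min (by norm_num) (by positivity)
  -- `log(Cg/(c₁/32)) = 2m + m log(3/2) + 32 m ≥ 0` is monotone in `m`
  have hlog : ∀ m : ℕ, Real.log ((Real.exp (2 * m) * (3 / 2) ^ m) / ((32 * Real.exp (-(32 * m))) * ((1 : ℝ) / 32))) =
      (34 + Real.log (3 / 2)) * m := by
    intro m
    rw [show (32 * Real.exp (-(32 * (m : ℝ)))) * ((1 : ℝ) / 32) = Real.exp (-(32 * m)) by ring,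
      Real.log_div (by positivity) (Real.exp_pos _).ne', Real.log_mul (Real.exp_pos _).ne' (by positivity), Real.log_exp,
      Real.log_exp, Real.log_pow]
    ring
  have hcof_anti : ∀ m m' : ℕ, m ≤ m' → cof m' ≤ cof m := by
    intro m m' hmm
    have hmm' : (m : ℝ) ≤ m' := by exact_mod_cast hmm
    have hl32 : 0 ≤ Real.log (3 / 2 : ℝ) := Real.log_nonneg (by norm_num)
    rw [hcof]; dsimp only
    rw [hlog m, hlog m', abs_of_nonneg (by positivity), abs_of_nonneg (by positivity)]
    refine min_le_min le_rfl (one_div_le_one_div_of_le (by positivity) ?_)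
    have : (34 + Real.log (3 / 2)) * (m : ℝ) ≤ (34 + Real.log (3 / 2)) * m' := mul_le_mul_of_nonneg_left hmm' (by positivity)
    nlinarith
  refine ⟨cof n, hcof_pos n, fun K _ _ hnK 𝔪 ψ hψ hnt D β₀ β₁ hne h₀ h₁ ↦ ?_⟩
  have h𝔪 := D.modulus_ne_bot
  have hQ1 := one_le_discr_mul_absNorm K h𝔪
  have hL4 : 0 < Real.log (((discr K).natAbs : ℝ) * ((Ideal.absNorm 𝔪 : ℕ) : ℝ)) + Real.log 4 := by
    have := Real.log_nonneg hQ1; have : 0 < Real.log (4 : ℝ) := Real.log_pos (by norm_num); linarith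
  have h₀' : D.LMod β₀ = 0 := by rw [RayClassPrimitiveData.LMod, h₀, zero_mul]
  have h₁' : D.LMod β₁ = 0 := by rw [RayClassPrimitiveData.LMod, h₁, zero_mul]
  have key : min β₀ β₁ ≤ 1 - cof (Module.finrank ℚ K) /
      (Real.log (((discr K).natAbs : ℝ) * ((Ideal.absNorm 𝔪 : ℕ) : ℝ)) + Real.log 4) := by
    by_cases h2 : ∀ v : HeightOneSpectrum (𝓞 K), ¬ 𝔪 ≤ v.asIdeal → ψ v ^ 2 = 1
    · have hdat := D.uniformTwistedZFRData_of_eq hnt h2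
      have := hdat.min_realZeros_le h₀' h₁' hne
      simpa [hcof] using this
    · push Not at h2
      have hdat := D.uniformTwistedZFRData_of_ne hψ hnt h2
      have := hdat.min_realZeros_le h₀' h₁' hne
      simpa [hcof] using this
  refine key.trans ?_
  have := hcof_anti _ _ hnK
  gcongr

/-! ### Landau: two different real characters `mod 𝔪` -/

/-- `(ψ₁ψ₂)(𝔞) = ψ₁(𝔞)ψ₂(𝔞)` for the coefficients `mod 𝔪`. [cite: MontgomeryVaughan2007, Lemma 11.6] -/
theorem rayClassCoeffHom_mul (𝔪 : Ideal (𝓞 K)) (ψ₁ ψ₂ : HeightOneSpectrum (𝓞 K) → ℂ) (I : Ideal (𝓞 K)) :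
    rayClassCoeffHom 𝔪 (fun v ↦ ψ₁ v * ψ₂ v) I = rayClassCoeffHom 𝔪 ψ₁ I * rayClassCoeffHom 𝔪 ψ₂ I := by
  rw [rayClassCoeffHom_apply, rayClassCoeffHom_apply, rayClassCoeffHom_apply, rayClassCoeff, rayClassCoeff, rayClassCoeff]
  split_ifs with h
  · unfold idealPow
    rw [← finprod_mul_distrib (mulSupport_idealPow_finite ψ₁ h.1) (mulSupport_idealPow_finite ψ₂ h.1)]
    exact finprod_congr fun v ↦ mul_pow _ _ _
  · simp

/-- The coefficient of a real character `mod 𝔪` (`ψ(𝔭)² = 1` off `𝔪`) is real, in `[-1, 1]`.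
[cite: MontgomeryVaughan2007, Lemma 11.6] -/
theorem rayClassCoeffHom_eq_re_of_real (h𝔪 : 𝔪 ≠ ⊥)
    (h2 : ∀ v : HeightOneSpectrum (𝓞 K), ¬ 𝔪 ≤ v.asIdeal → ψ v ^ 2 = 1) (I : Ideal (𝓞 K)) :
    rayClassCoeffHom 𝔪 ψ I = ((rayClassCoeffHom 𝔪 ψ I).re : ℂ) ∧ -1 ≤ (rayClassCoeffHom 𝔪 ψ I).re ∧
      (rayClassCoeffHom 𝔪 ψ I).re ≤ 1 := by
  have hψ1 : ∀ v : HeightOneSpectrum (𝓞 K), ¬ 𝔪 ≤ v.asIdeal → ‖ψ v‖ ≤ 1 := fun v hv ↦ by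
    have h := h2 v hv
    have : ‖ψ v‖ ^ 2 = 1 := by rw [← norm_pow, h, norm_one]
    nlinarith [norm_nonneg (ψ v)]
  have hnorm : ‖rayClassCoeffHom 𝔪 ψ I‖ ≤ 1 := norm_rayClassCoeffHom_le h𝔪 hψ1 I
  have hsq : rayClassCoeffHom 𝔪 ψ I ^ 2 = rayClassCoeffHom 𝔪 (fun v ↦ ψ v ^ 2) I := (rayClassCoeffHom_sq 𝔪 ψ I).symm
  have hsq' : rayClassCoeffHom 𝔪 (fun v ↦ ψ v ^ 2) I = rayClassCoeffHom 𝔪 (fun _ ↦ (1 : ℂ)) I := by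
    rw [rayClassCoeffHom_apply, rayClassCoeffHom_apply]; exact rayClassCoeff_congr h𝔪 h2 I
  -- the value is `0` or a square root of `1`
  have hval : rayClassCoeffHom 𝔪 ψ I = 0 ∨ rayClassCoeffHom 𝔪 ψ I = 1 ∨ rayClassCoeffHom 𝔪 ψ I = -1 := by
    by_cases h : I ≠ ⊥ ∧ IsCoprime I 𝔪
    · have e3 : rayClassCoeffHom 𝔪 (fun _ ↦ (1 : ℂ)) I = 1 := by
        rw [rayClassCoeffHom_apply, rayClassCoeff, if_pos h]
        unfold idealPow; exact finprod_eq_one_of_forall_eq_one fun v ↦ one_pow _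
      rw [hsq', e3, sq, mul_self_eq_one_iff] at hsq
      exact Or.inr hsq
    · left; rw [rayClassCoeffHom_apply, rayClassCoeff, if_neg h]
  rcases hval with h | h | h <;> rw [h] <;> norm_num

/-- The terms of `L(Λ_K,σ) + L(Λ_{ψ₁},σ) + L(Λ_{ψ₂},σ) + L(Λ_{ψ₁ψ₂},σ)` at real `σ` have non-negative real part for real
`ψ₁, ψ₂ mod 𝔪`: `Σ_{N𝔞 = n} Λ(𝔞)(1 + ψ₁(𝔞))(1 + ψ₂(𝔞)) n^{-σ} ≥ 0`. [cite: MontgomeryVaughan2007, Lemma 11.6] -/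
theorem re_landau_terms_nonneg_rayClass (h𝔪 : 𝔪 ≠ ⊥) {ψ₁ ψ₂ : HeightOneSpectrum (𝓞 K) → ℂ}
    (h₁ : ∀ v : HeightOneSpectrum (𝓞 K), ¬ 𝔪 ≤ v.asIdeal → ψ₁ v ^ 2 = 1)
    (h₂ : ∀ v : HeightOneSpectrum (𝓞 K), ¬ 𝔪 ≤ v.asIdeal → ψ₂ v ^ 2 = 1) (σ : ℝ) (n : ℕ) :
    0 ≤ (LSeries.term (fun n ↦ (vonMangoldtNorm K n : ℂ)) σ n).re +
      (LSeries.term (twistVonMangoldt K (rayClassCoeffHom 𝔪 ψ₁)) σ n).re +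
      (LSeries.term (twistVonMangoldt K (rayClassCoeffHom 𝔪 ψ₂)) σ n).re +
      (LSeries.term (twistVonMangoldt K (rayClassCoeffHom 𝔪 (fun v ↦ ψ₁ v * ψ₂ v))) σ n).re := by
  rcases eq_or_ne n 0 with rfl | hn
  · simp
  set r : ℝ := ((n : ℝ) ^ σ)⁻¹ with hr
  have hr0 : 0 ≤ r := by positivity
  have hterm : ∀ f : ℕ → ℂ, LSeries.term f σ n = (r : ℂ) * f n := by
    intro f
    have := term_eq_inv_rpow_mul f σ 0 hn
    simp only [Complex.ofReal_zero, zero_mul, add_zero, neg_zero, Complex.cpow_zero, mul_one] at this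
    rw [this, hr]
  rw [hterm, hterm, hterm, hterm, Complex.re_ofReal_mul, Complex.re_ofReal_mul, Complex.re_ofReal_mul,
    Complex.re_ofReal_mul, ← mul_add, ← mul_add, ← mul_add]
  refine mul_nonneg hr0 ?_
  have hsum : ((vonMangoldtNorm K n : ℂ)).re + (twistVonMangoldt K (rayClassCoeffHom 𝔪 ψ₁) n).re +
      (twistVonMangoldt K (rayClassCoeffHom 𝔪 ψ₂) n).re +
      (twistVonMangoldt K (rayClassCoeffHom 𝔪 (fun v ↦ ψ₁ v * ψ₂ v)) n).re =
      ∑ B ∈ idealsOfNorm K n, idealVonMangoldt B *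
        ((1 + (rayClassCoeffHom 𝔪 ψ₁ B).re) * (1 + (rayClassCoeffHom 𝔪 ψ₂ B).re)) := by
    unfold vonMangoldtNorm twistVonMangoldt
    rw [Complex.ofReal_re, Complex.re_sum, Complex.re_sum, Complex.re_sum, ← Finset.sum_add_distrib,
      ← Finset.sum_add_distrib, ← Finset.sum_add_distrib]
    refine Finset.sum_congr rfl fun B _ ↦ ?_
    obtain ⟨e₁, -, -⟩ := rayClassCoeffHom_eq_re_of_real h𝔪 h₁ B
    obtain ⟨e₂, -, -⟩ := rayClassCoeffHom_eq_re_of_real h𝔪 h₂ B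
    rw [rayClassCoeffHom_mul, e₁, e₂]
    simp only [← Complex.ofReal_mul, Complex.ofReal_re]
    ring
  rw [hsum]
  refine Finset.sum_nonneg fun B _ ↦ mul_nonneg (idealVonMangoldt_nonneg B) ?_
  obtain ⟨-, ha, -⟩ := rayClassCoeffHom_eq_re_of_real h𝔪 h₁ B
  obtain ⟨-, hb, -⟩ := rayClassCoeffHom_eq_re_of_real h𝔪 h₂ B
  exact mul_nonneg (by linarith) (by linarith)

/-- **MV Lemma 11.6 for real ray class characters `mod 𝔪`**: for real `σ > 1`,
`Re[L(Λ_K,σ) + L(Λ_{ψ₁},σ) + L(Λ_{ψ₂},σ) + L(Λ_{ψ₁ψ₂},σ)] ≥ 0`. [cite: MontgomeryVaughan2007, Lemma 11.6] -/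
theorem landau_positivity_rayClass (h𝔪 : 𝔪 ≠ ⊥) {ψ₁ ψ₂ : HeightOneSpectrum (𝓞 K) → ℂ}
    (h₁ : ∀ v : HeightOneSpectrum (𝓞 K), ¬ 𝔪 ≤ v.asIdeal → ψ₁ v ^ 2 = 1)
    (h₂ : ∀ v : HeightOneSpectrum (𝓞 K), ¬ 𝔪 ≤ v.asIdeal → ψ₂ v ^ 2 = 1) {σ : ℝ} (hσ : 1 < σ) :
    0 ≤ (LSeries (fun n ↦ (vonMangoldtNorm K n : ℂ)) σ).re +
      (LSeries (twistVonMangoldt K (rayClassCoeffHom 𝔪 ψ₁)) σ).re +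
      (LSeries (twistVonMangoldt K (rayClassCoeffHom 𝔪 ψ₂)) σ).re +
      (LSeries (twistVonMangoldt K (rayClassCoeffHom 𝔪 (fun v ↦ ψ₁ v * ψ₂ v))) σ).re := by
  have hs1 : 1 < (σ : ℂ).re := by simp [hσ]
  have hn1 : ∀ ψ : HeightOneSpectrum (𝓞 K) → ℂ, (∀ v : HeightOneSpectrum (𝓞 K), ¬ 𝔪 ≤ v.asIdeal → ψ v ^ 2 = 1) →
      ∀ v : HeightOneSpectrum (𝓞 K), ¬ 𝔪 ≤ v.asIdeal → ‖ψ v‖ ≤ 1 := fun ψ h v hv ↦ by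
    have : ‖ψ v‖ ^ 2 = 1 := by rw [← norm_pow, h v hv, norm_one]
    nlinarith [norm_nonneg (ψ v)]
  have h12 : ∀ v : HeightOneSpectrum (𝓞 K), ¬ 𝔪 ≤ v.asIdeal → ‖ψ₁ v * ψ₂ v‖ ≤ 1 := fun v hv ↦ by
    rw [norm_mul]; exact mul_le_one₀ (hn1 ψ₁ h₁ v hv) (norm_nonneg _) (hn1 ψ₂ h₂ v hv)
  have hA := (LSeriesSummable_vonMangoldtNorm (K := K) hs1).hasSum
  have hB := (LSeriesSummable_twistVonMangoldt (norm_rayClassCoeffHom_le h𝔪 (hn1 ψ₁ h₁)) hs1).hasSum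
  have hC := (LSeriesSummable_twistVonMangoldt (norm_rayClassCoeffHom_le h𝔪 (hn1 ψ₂ h₂)) hs1).hasSum
  have hD := (LSeriesSummable_twistVonMangoldt (norm_rayClassCoeffHom_le h𝔪 h12) hs1).hasSum
  have hsum := (((hA.add hB).add hC).add hD).mapL Complex.reCLM
  simp only [Complex.reCLM_apply, Complex.add_re] at hsum
  exact hsum.nonneg fun n ↦ re_landau_terms_nonneg_rayClass h𝔪 h₁ h₂ σ n

/-- **Landau–Page for two different real characters `mod 𝔪`, uniformly in the field and the modulus** (MV Theorem 11.7;
the "at most one exceptional character" clause of [ThornerZaman2019, Theorem 3.1]): for every `n` there is `c = c(n) > 0`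
such that for every `K` with `n_K ≤ n`, `𝔪 ≠ 0`, two real ray class characters `ψ₁, ψ₂ mod 𝔪` (non-principal off `𝔪`)
whose product is non-principal off `𝔪` (i.e. `ψ₁ ≠ ψ₂` there), primitive data `D₁, D₂`, and real zeros `β₁` of `L(·,(ψ₁)₀)`,
`β₂` of `L(·,(ψ₂)₀)`: `min(β₁, β₂) ≤ 1 − c/(log(|d_K|N𝔪) + log 4)`. [cite: MontgomeryVaughan2007, Theorem 11.7] -/
theorem exists_landau_rayClass (n : ℕ) :
    ∃ c : ℝ, 0 < c ∧ ∀ (K : Type*) [Field K] [NumberField K], Module.finrank ℚ K ≤ n →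
      ∀ (𝔪 : Ideal (𝓞 K)) (ψ₁ ψ₂ : HeightOneSpectrum (𝓞 K) → ℂ),
      IsRayClassCharacter 𝔪 ψ₁ → IsRayClassCharacter 𝔪 ψ₂ →
      (∃ v : HeightOneSpectrum (𝓞 K), ¬ 𝔪 ≤ v.asIdeal ∧ ψ₁ v ≠ 1) →
      (∃ v : HeightOneSpectrum (𝓞 K), ¬ 𝔪 ≤ v.asIdeal ∧ ψ₂ v ≠ 1) →
      (∀ v : HeightOneSpectrum (𝓞 K), ¬ 𝔪 ≤ v.asIdeal → ψ₁ v ^ 2 = 1) →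
      (∀ v : HeightOneSpectrum (𝓞 K), ¬ 𝔪 ≤ v.asIdeal → ψ₂ v ^ 2 = 1) →
      (∃ v : HeightOneSpectrum (𝓞 K), ¬ 𝔪 ≤ v.asIdeal ∧ ψ₁ v * ψ₂ v ≠ 1) →
      ∀ (D₁ : RayClassPrimitiveData 𝔪 ψ₁) (D₂ : RayClassPrimitiveData 𝔪 ψ₂) (β₁ β₂ : ℝ),
        D₁.L β₁ = 0 → D₂.L β₂ = 0 →
        min β₁ β₂ ≤ 1 - c / (Real.log (((discr K).natAbs : ℝ) * ((Ideal.absNorm 𝔪 : ℕ) : ℝ)) + Real.log 4) := by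
  set cof : ℕ → ℝ := fun m ↦
    min (3 * (1 : ℝ) / 64) (1 / (6 * (77760 * (5 * (m : ℝ) + 2) +
      3 * (8 * (2 * ((m : ℝ) + 2) + |Real.log ((Real.exp (2 * m) * (3 / 2) ^ m) / ((32 * Real.exp (-(32 * m))) * ((1 : ℝ) / 32)))| + 1) /
        ((1 : ℝ) / 4)) + 1))) with hcof
  have hcof_pos : ∀ m, 0 < cof m := fun m ↦ by rw [hcof]; exact lt_min (by norm_num) (by positivity)
  have hlog : ∀ m : ℕ, Real.log ((Real.exp (2 * m) * (3 / 2) ^ m) / ((32 * Real.exp (-(32 * m))) * ((1 : ℝ) / 32))) =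
      (34 + Real.log (3 / 2)) * m := by
    intro m
    rw [show (32 * Real.exp (-(32 * (m : ℝ)))) * ((1 : ℝ) / 32) = Real.exp (-(32 * m)) by ring,
      Real.log_div (by positivity) (Real.exp_pos _).ne', Real.log_mul (Real.exp_pos _).ne' (by positivity), Real.log_exp,
      Real.log_exp, Real.log_pow]
    ring
  have hcof_anti : ∀ m m' : ℕ, m ≤ m' → cof m' ≤ cof m := by
    intro m m' hmm
    have hmm' : (m : ℝ) ≤ m' := by exact_mod_cast hmm
    have hl32 : 0 ≤ Real.log (3 / 2 : ℝ) := Real.log_nonneg (by norm_num)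
    rw [hcof]; dsimp only
    rw [hlog m, hlog m', abs_of_nonneg (by positivity), abs_of_nonneg (by positivity)]
    refine min_le_min le_rfl (one_div_le_one_div_of_le (by positivity) ?_)
    have : (34 + Real.log (3 / 2)) * (m : ℝ) ≤ (34 + Real.log (3 / 2)) * m' := mul_le_mul_of_nonneg_left hmm' (by positivity)
    nlinarith
  refine ⟨cof n, hcof_pos n, fun K _ _ hnK 𝔪 ψ₁ ψ₂ hψ₁ hψ₂ hnt₁ hnt₂ h₁ h₂ h12 D₁ D₂ β₁ β₂ hz₁ hz₂ ↦ ?_⟩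
  have h𝔪 := D₁.modulus_ne_bot
  have hQ1 := one_le_discr_mul_absNorm K h𝔪
  have hL4 : 0 < Real.log (((discr K).natAbs : ℝ) * ((Ideal.absNorm 𝔪 : ℕ) : ℝ)) + Real.log 4 := by
    have := Real.log_nonneg hQ1; have : 0 < Real.log (4 : ℝ) := Real.log_pos (by norm_num); linarith
  -- the product character: real, non-principal, a ray class character
  have hψ12 : IsRayClassCharacter 𝔪 (fun v ↦ ψ₁ v * ψ₂ v) :=
    { norm_eq_one := fun v hv ↦ by rw [norm_mul, hψ₁.norm_eq_one v hv, hψ₂.norm_eq_one v hv, one_mul]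
      idealPow_span_eq := fun b c hb hc hcop hbc hpos ↦ by
        have e : ∀ I : Ideal (𝓞 K), I ≠ ⊥ → idealPow K (fun v ↦ ψ₁ v * ψ₂ v) I = idealPow K ψ₁ I * idealPow K ψ₂ I := by
          intro I hI; unfold idealPow
          rw [← finprod_mul_distrib (mulSupport_idealPow_finite ψ₁ hI) (mulSupport_idealPow_finite ψ₂ hI)]
          exact finprod_congr fun v ↦ mul_pow _ _ _
        rw [e _ (by simpa using hb), e _ (by simpa using hc), hψ₁.idealPow_span_eq b c hb hc hcop hbc hpos,
          hψ₂.idealPow_span_eq b c hb hc hcop hbc hpos] }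
  have h12sq : ∀ v : HeightOneSpectrum (𝓞 K), ¬ 𝔪 ≤ v.asIdeal → (ψ₁ v * ψ₂ v) ^ 2 = 1 := fun v hv ↦ by
    rw [mul_pow, h₁ v hv, h₂ v hv, one_mul]
  set D₁₂ := rayClassPrimitiveData hψ12 h𝔪 h12
  have hd₁ := D₁.uniformTwistedZFRData_of_eq hnt₁ h₁
  have hd₂ := D₂.uniformTwistedZFRData_of_eq hnt₂ h₂
  have hd₁₂ := D₁₂.uniformTwistedZFRData_of_eq h12 h12sq
  have hz₁' : D₁.LMod β₁ = 0 := by rw [RayClassPrimitiveData.LMod, hz₁, zero_mul]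
  have hz₂' : D₂.LMod β₂ = 0 := by rw [RayClassPrimitiveData.LMod, hz₂, zero_mul]
  have hlt₁ := D₁.realZero_lt_one hnt₁ hz₁'
  have hlt₂ := D₂.realZero_lt_one hnt₂ hz₂'
  have key := UniformTwistedZFRData.landau_min_le hd₁ hd₂ hd₁₂
    (fun σ hσ ↦ landau_positivity_rayClass h𝔪 h₁ h₂ hσ) hz₁' hz₂' hlt₁ hlt₂
  have key' : min β₁ β₂ ≤ 1 - cof (Module.finrank ℚ K) /
      (Real.log (((discr K).natAbs : ℝ) * ((Ideal.absNorm 𝔪 : ℕ) : ℝ)) + Real.log 4) := by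
    simpa [hcof] using key
  refine key'.trans ?_
  have := hcof_anti _ _ hnK
  gcongr

end Literature.NumberTheory.LFunctions

end
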